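import Summits.ValiantsHypothesis.ValiantsHypothesis.Theorems.KPlusLogSqLawWeakLiftingTowerGraftTwoSidedThreeLetters

/-!
# Tower graft line — THE TWO-SIDED THREE-LETTER LAW, part C: general exponent gaps `(d, d+e, d+(n+1)e)` through an ABSTRACT
# LOEWNER CERTIFICATE, with the algebraic instances `n = 1` (quadratic), `n = 2` (Cauchy, part A) and `n = 4` (Cauchy ⊙ Cauchy)

Part C of `…TowerGraftTwoSidedThreeLetters.lean` (crux `stmt-ValiantsHypothesis-19561`, line (B) `tower_graft`, two-sided word
instrument; seat val-sym-lift-p3 g20, `--supports 19561`, NO stub claimed).  For the reduced pencil `A + s J + s^{n+1} B`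
(`s = t^e`; `A, B ⪰ 0`, `J` any symmetric) the kernel relations at two distinct scales give the GRAM IDENTITY
`(sᵢ − sₖ)·⟨uᵢ,Auₖ⟩ = sᵢsₖ(sᵢⁿ − sₖⁿ)·⟨uᵢ,Buₖ⟩` (`gramA_eq_gen`), i.e. `⟨uᵢ,Buₖ⟩ = N_{ik}·⟨uᵢ,Auₖ⟩` with
`N_{ik} = (sᵢ − sₖ)/(sᵢsₖ(sᵢⁿ − sₖⁿ)) = 1/(sᵢsₖ·h_{n−1}(sᵢ,sₖ))` — up to the diagonal scaling the LOEWNER MATRIX of the operator-monotone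
power `y ↦ y^{1/n}` at the nodes `yᵢ = sᵢⁿ`.  Whenever a positive semidefinite `N` with these off-diagonal entries and the diagonal
`N_{ii} = 1/(n sᵢ^{n+1})` is supplied, the positive-type kernel pairs (Rayleigh trinomial increasing: `⟨u,Au⟩ < n s^{n+1}⟨u,Bu⟩`) number at
most `rank B` (`card_posType_le_rank_of_certificate`) — the same Schur-product argument as part A.  Certificates typed here:
* `n = 1` (`(d, d+e, d+2e)`, the quadratic pencil): `N = [1/(sᵢsₖ)]` is rank one (`card_posType_le_rank_gap_one`);
* `n = 2` (`(d, d+e, d+3e)`): part A's Cauchy certificate, re-derived from the abstract form (`card_posType_le_rank_gap_two`);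
* `n = 4` (`(d, d+e, d+5e)`, e.g. the 3-tower `(0,1,5)` of the cell's column): `h₃(x,y) = (x+y)(x²+y²)`, so
  `N = D⁻¹(Cauchy(s) ⊙ Cauchy(s²))D⁻¹ ⪰ 0` (`card_posType_le_rank_gap_four`).
The MIRROR (`t ↦ 1/t`): on `(d, d+ne, d+(n+1)e)` (pivot adjacent to the TOP letter) NEGATIVE-type roots number at most `rank A`
(`card_negType_le_rank_of_certificate`, instance `card_negType_le_rank_gap_two` for `(d, d+2e, d+3e)`).
In general `b − e = 2^k·e` factors into `k` Cauchy kernels; other gaps (e.g. `n = 3`, the 3-tower `(0,1,4)`) need Loewner's theorem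
for `y^{1/n}` (true, not typed).  The `2m` law for simple crossings follows on each certified support exactly as in part B (typed there
for `n = 2` only).  HONEST FRAMING as in parts A/B: a structural law for THREE letters; nothing on the four-letter column, S4…S5,
`TowerB`, `WeakLifting` in its window, Conjecture B, 18050 or `VP ≠ VNP`.  Def-free; Mathlib + part A.

[folklore] Loewner matrices of operator monotone powers; Cauchy matrices; Schur product theorem.
-/

set_option linter.dupNamespace false
set_option autoImplicit false

namespace Summit.ValiantsHypothesis.ValiantsHypothesis.Theorems.KPlusLogSqLaw.TowerGraft

open Matrix
open scoped BigOperators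

namespace TwoSidedThree

variable {m : ℕ} {I : Type} [Fintype I] [DecidableEq I]

section General

variable (A J B : Matrix (Fin m) (Fin m) ℝ) (n : ℕ) (s : I → ℝ) (u : I → Fin m → ℝ)

omit [Fintype I] [DecidableEq I] in
/-- a real symmetric form is symmetric in its two arguments. [folklore] -/
theorem form_comm {S : Matrix (Fin m) (Fin m) ℝ} (hS : S.IsSymm) (x y : Fin m → ℝ) :
    x ⬝ᵥ (S *ᵥ y) = y ⬝ᵥ (S *ᵥ x) := by
  rw [dotProduct_mulVec_symm hS, dotProduct_comm]

omit [Fintype I] [DecidableEq I] in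
/-- kernel relation of the reduced pencil `A + s J + s^{n+1} B`, polarised. [folklore] -/
theorem gram_rel_gen (hA : A.IsSymm) (hJ : J.IsSymm) (hB : B.IsSymm)
    (hker : ∀ i, (A + s i • J + s i ^ (n + 1) • B) *ᵥ u i = 0) (i k : I) :
    u i ⬝ᵥ (A *ᵥ u k) + s i * (u i ⬝ᵥ (J *ᵥ u k)) + s i ^ (n + 1) * (u i ⬝ᵥ (B *ᵥ u k)) = 0 := by
  have h := congrArg (fun w => u k ⬝ᵥ w) (hker i)
  simp only [dotProduct_zero, Matrix.add_mulVec, Matrix.smul_mulVec, dotProduct_add, dotProduct_smul,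
    smul_eq_mul] at h
  rw [form_comm hA (u k) (u i), form_comm hJ (u k) (u i), form_comm hB (u k) (u i)] at h
  linarith

omit [Fintype I] [DecidableEq I] in
/-- **the general Gram identity**: `(sᵢ − sₖ)·⟨uᵢ,Auₖ⟩ = sᵢsₖ(sᵢⁿ − sₖⁿ)·⟨uᵢ,Buₖ⟩`. [folklore] -/
theorem gramA_eq_gen (hA : A.IsSymm) (hJ : J.IsSymm) (hB : B.IsSymm)
    (hker : ∀ i, (A + s i • J + s i ^ (n + 1) • B) *ᵥ u i = 0) (i k : I) :
    (s i - s k) * (u i ⬝ᵥ (A *ᵥ u k)) = s i * s k * (s i ^ n - s k ^ n) * (u i ⬝ᵥ (B *ᵥ u k)) := by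
  have h1 := gram_rel_gen A J B n s u hA hJ hB hker i k
  have h2 := gram_rel_gen A J B n s u hA hJ hB hker k i
  rw [form_comm hA (u k) (u i), form_comm hJ (u k) (u i), form_comm hB (u k) (u i)] at h2
  linear_combination (-(s k)) * h1 + (s i) * h2

/-- **THE TWO-SIDED THREE-LETTER LAW through an abstract Loewner certificate (gap `n`).**  `A, B ⪰ 0`, `J` symmetric; pairs
`(sᵢ, uᵢ)` of DISTINCT positive scales and kernel vectors of `A + sᵢ J + sᵢ^{n+1} B` of positive type (`⟨uᵢ,Auᵢ⟩ < n sᵢ^{n+1}⟨uᵢ,Buᵢ⟩`);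
a positive semidefinite CERTIFICATE `N` with `N_{ii}·(n sᵢ^{n+1}) = 1` and `N_{ik}·sᵢsₖ(sᵢⁿ − sₖⁿ) = sᵢ − sₖ` (`i ≠ k`).  Then `#I ≤ rank B`.
[folklore] -/
theorem card_posType_le_rank_of_certificate (hA : A.PosSemidef) (hJ : J.IsSymm) (hB : B.PosSemidef)
    (hs : ∀ i, 0 < s i) (hinj : Function.Injective s)
    (hker : ∀ i, (A + s i • J + s i ^ (n + 1) • B) *ᵥ u i = 0)
    (htype : ∀ i, u i ⬝ᵥ (A *ᵥ u i) < n * s i ^ (n + 1) * (u i ⬝ᵥ (B *ᵥ u i)))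
    (N : Matrix I I ℝ) (hN : N.PosSemidef) (hNdiag : ∀ i, N i i * (n * s i ^ (n + 1)) = 1)
    (hNoff : ∀ i k, i ≠ k → N i k * (s i * s k * (s i ^ n - s k ^ n)) = s i - s k) :
    Fintype.card I ≤ B.rank := by
  classical
  have hAs : A.IsSymm := by
    have h1 := hA.1; unfold Matrix.IsHermitian at h1
    rwa [Matrix.conjTranspose_eq_transpose_of_trivial] at h1
  have hBs : B.IsSymm := by
    have h1 := hB.1; unfold Matrix.IsHermitian at h1
    rwa [Matrix.conjTranspose_eq_transpose_of_trivial] at h1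
  -- the PSD summand `Gram_A ⊙ N`
  have hGA : (Matrix.of fun i' k' => u i' ⬝ᵥ (A *ᵥ u k')).PosSemidef := posSemidef_gram hA u
  have hH : ((Matrix.of fun i' k' => u i' ⬝ᵥ (A *ᵥ u k')) ⊙ N).PosSemidef := hGA.hadamard hN
  -- the decomposition `Gram_B = Gram_A ⊙ N + Δ`
  set Δ : I → ℝ := fun i => u i ⬝ᵥ (B *ᵥ u i) - (u i ⬝ᵥ (A *ᵥ u i)) * N i i with hΔdef
  have hΔpos : ∀ i, 0 < Δ i := by
    intro i
    have ht := htype i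
    have hn : (0 : ℝ) < n := by
      rcases Nat.eq_zero_or_pos n with h0 | h0
      · exfalso
        subst h0
        have ha : 0 ≤ u i ⬝ᵥ (A *ᵥ u i) := by
          have h := (Matrix.posSemidef_iff_dotProduct_mulVec.mp hA).2 (u i)
          rwa [star_trivial] at h
        simp only [Nat.cast_zero, zero_mul] at ht
        linarith
      · exact_mod_cast h0
    have hsi : 0 < (n : ℝ) * s i ^ (n + 1) := by have := hs i; positivity
    have hNii : N i i = 1 / (n * s i ^ (n + 1)) := by
      rw [eq_div_iff (ne_of_gt hsi)]
      exact hNdiag i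
    show 0 < u i ⬝ᵥ (B *ᵥ u i) - (u i ⬝ᵥ (A *ᵥ u i)) * N i i
    rw [hNii, sub_pos, mul_one_div, div_lt_iff₀ hsi]
    linarith
  have hdecomp : (Matrix.of fun i' k' => u i' ⬝ᵥ (B *ᵥ u k'))
      = (Matrix.of fun i' k' => u i' ⬝ᵥ (A *ᵥ u k')) ⊙ N + Matrix.diagonal Δ := by
    ext i k
    rw [Matrix.add_apply, Matrix.hadamard_apply, Matrix.of_apply, Matrix.of_apply]
    by_cases hik : i = k
    · subst hik
      rw [Matrix.diagonal_apply_eq]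
      simp only [hΔdef]; ring
    · rw [Matrix.diagonal_apply_ne _ hik, add_zero]
      have h1 := gramA_eq_gen A J B n s u hAs hJ hBs hker i k
      have h2 := hNoff i k hik
      have hne : s i - s k ≠ 0 := sub_ne_zero.mpr (fun h => hik (hinj h))
      have hne' : s i * s k * (s i ^ n - s k ^ n) ≠ 0 := by
        intro h0; rw [h0, mul_zero] at h2; exact hne h2.symm
      -- `b = a N`: multiply by the non-zero factor
      have h3 : (u i ⬝ᵥ (B *ᵥ u k)) * (s i * s k * (s i ^ n - s k ^ n))
          = (u i ⬝ᵥ (A *ᵥ u k)) * N i k * (s i * s k * (s i ^ n - s k ^ n)) := by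
        rw [mul_assoc (u i ⬝ᵥ (A *ᵥ u k)), h2]; linarith
      exact mul_right_cancel₀ hne' h3
  -- `Gram_B ≻ 0`
  have hGB : (Matrix.of fun i' k' => u i' ⬝ᵥ (B *ᵥ u k')).PosDef := by
    rw [Matrix.posDef_iff_dotProduct_mulVec]
    refine ⟨(posSemidef_gram hB u).1, fun x hx => ?_⟩
    rw [hdecomp, Matrix.add_mulVec, dotProduct_add]
    have h1 : 0 ≤ star x ⬝ᵥ (((Matrix.of fun i' k' => u i' ⬝ᵥ (A *ᵥ u k')) ⊙ N) *ᵥ x) :=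
      (Matrix.posSemidef_iff_dotProduct_mulVec.mp hH).2 x
    have h2 : 0 < star x ⬝ᵥ (Matrix.diagonal Δ *ᵥ x) := by
      rw [star_trivial]
      simp only [dotProduct, Matrix.mulVec_diagonal]
      obtain ⟨i₀, hi₀⟩ := Function.ne_iff.mp hx
      apply Finset.sum_pos'
      · intro i _
        have := hΔpos i
        nlinarith [sq_nonneg (x i)]
      · refine ⟨i₀, Finset.mem_univ _, ?_⟩
        have := hΔpos i₀
        have hx0 : 0 < x i₀ ^ 2 := sq_pos_iff.mpr hi₀
        nlinarith
    linarith
  have hrank : (Matrix.of fun i' k' => u i' ⬝ᵥ (B *ᵥ u k')).rank = Fintype.card I := Matrix.rank_of_isUnit _ hGB.isUnit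
  rw [← hrank]
  exact rank_gram_le B u

end General

/-! ## Certificates -/

section Certificates

variable (A J B : Matrix (Fin m) (Fin m) ℝ) (s : I → ℝ) (u : I → Fin m → ℝ)

/-- **gap `n = 1` (`(d, d+e, d+2e)`, quadratic pencil)**: certificate `N = [1/(sᵢsₖ)]` (rank one).  Positive type:
`⟨u,Au⟩ < s²⟨u,Bu⟩`. [folklore] -/
theorem card_posType_le_rank_gap_one (hA : A.PosSemidef) (hJ : J.IsSymm) (hB : B.PosSemidef)
    (hs : ∀ i, 0 < s i) (hinj : Function.Injective s)
    (hker : ∀ i, (A + s i • J + s i ^ 2 • B) *ᵥ u i = 0)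
    (htype : ∀ i, u i ⬝ᵥ (A *ᵥ u i) < s i ^ 2 * (u i ⬝ᵥ (B *ᵥ u i))) :
    Fintype.card I ≤ B.rank := by
  refine card_posType_le_rank_of_certificate A J B 1 s u hA hJ hB hs hinj (by simpa using hker)
    (fun i => by simpa using htype i) (Matrix.vecMulVec (fun i => (s i)⁻¹) (fun i => (s i)⁻¹)) ?_ ?_ ?_
  · have h := Matrix.posSemidef_vecMulVec_self_star (R := ℝ) (fun i : I => (s i)⁻¹)
    rwa [star_trivial] at h
  · intro i
    simp only [Matrix.vecMulVec_apply, Nat.cast_one, one_mul]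
    have := ne_of_gt (hs i)
    field_simp
  · intro i k _
    simp only [Matrix.vecMulVec_apply]
    have := ne_of_gt (hs i); have := ne_of_gt (hs k)
    field_simp

/-- **gap `n = 2` (`(d, d+e, d+3e)`)**: the Cauchy certificate of part A in the abstract form, `N = [1/(sᵢsₖ(sᵢ+sₖ))]`. [folklore] -/
theorem card_posType_le_rank_gap_two (hA : A.PosSemidef) (hJ : J.IsSymm) (hB : B.PosSemidef)
    (hs : ∀ i, 0 < s i) (hinj : Function.Injective s)
    (hker : ∀ i, (A + s i • J + s i ^ 3 • B) *ᵥ u i = 0)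
    (htype : ∀ i, u i ⬝ᵥ (A *ᵥ u i) < 2 * s i ^ 3 * (u i ⬝ᵥ (B *ᵥ u i))) :
    Fintype.card I ≤ B.rank := by
  classical
  set N : Matrix I I ℝ := Matrix.of fun i k => (s i)⁻¹ * (1 / (s i + s k)) * (s k)⁻¹ with hNdef
  refine card_posType_le_rank_of_certificate A J B 2 s u hA hJ hB hs hinj (by simpa using hker)
    (fun i => by have := htype i; push_cast; linarith) N ?_ ?_ ?_
  · -- `N = D⁻¹ C D⁻¹`
    have hNeq : N = (Matrix.diagonal fun i => (s i)⁻¹) * (Matrix.of fun i k : I => 1 / (s i + s k))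
        * (Matrix.diagonal fun i => (s i)⁻¹) := by
      ext i k
      simp only [hNdef, Matrix.of_apply, Matrix.mul_diagonal, Matrix.diagonal_mul]
    rw [hNeq]
    have h := (posSemidef_cauchy s hs).conjTranspose_mul_mul_same (Matrix.diagonal fun i => (s i)⁻¹)
    rwa [Matrix.conjTranspose_eq_transpose_of_trivial, Matrix.diagonal_transpose] at h
  · intro i
    simp only [hNdef, Matrix.of_apply]
    have := ne_of_gt (hs i)
    field_simp
    ring
  · intro i k _
    simp only [hNdef, Matrix.of_apply]
    have := ne_of_gt (hs i); have := ne_of_gt (hs k); have := ne_of_gt (add_pos (hs i) (hs k))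
    field_simp
    ring

/-- **gap `n = 4` (`(d, d+e, d+5e)`)**: `h₃(x,y) = (x+y)(x²+y²)`, certificate `N = D⁻¹(Cauchy(s) ⊙ Cauchy(s²))D⁻¹ ⪰ 0` by Schur's
product theorem.  Positive type: `⟨u,Au⟩ < 4s⁵⟨u,Bu⟩`. [folklore] -/
theorem card_posType_le_rank_gap_four (hA : A.PosSemidef) (hJ : J.IsSymm) (hB : B.PosSemidef)
    (hs : ∀ i, 0 < s i) (hinj : Function.Injective s)
    (hker : ∀ i, (A + s i • J + s i ^ 5 • B) *ᵥ u i = 0)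
    (htype : ∀ i, u i ⬝ᵥ (A *ᵥ u i) < 4 * s i ^ 5 * (u i ⬝ᵥ (B *ᵥ u i))) :
    Fintype.card I ≤ B.rank := by
  classical
  set N : Matrix I I ℝ := Matrix.of fun i k => (s i)⁻¹ * (1 / (s i + s k) * (1 / (s i ^ 2 + s k ^ 2))) * (s k)⁻¹ with hNdef
  refine card_posType_le_rank_of_certificate A J B 4 s u hA hJ hB hs hinj (by simpa using hker)
    (fun i => by have := htype i; push_cast; linarith) N ?_ ?_ ?_
  · have hC1 := posSemidef_cauchy s hs
    have hC2 := posSemidef_cauchy (fun i => s i ^ 2) (fun i => pow_pos (hs i) 2)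
    have hH := hC1.hadamard hC2
    have hNeq : N = (Matrix.diagonal fun i => (s i)⁻¹)
        * ((Matrix.of fun i k : I => 1 / (s i + s k)) ⊙ (Matrix.of fun i k : I => 1 / (s i ^ 2 + s k ^ 2)))
        * (Matrix.diagonal fun i => (s i)⁻¹) := by
      ext i k
      simp only [hNdef, Matrix.of_apply, Matrix.mul_diagonal, Matrix.diagonal_mul, Matrix.hadamard_apply]
    rw [hNeq]
    have h := hH.conjTranspose_mul_mul_same (Matrix.diagonal fun i => (s i)⁻¹)
    rwa [Matrix.conjTranspose_eq_transpose_of_trivial, Matrix.diagonal_transpose] at h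
  · intro i
    simp only [hNdef, Matrix.of_apply]
    have := ne_of_gt (hs i)
    field_simp
    ring
  · intro i k _
    simp only [hNdef, Matrix.of_apply]
    have := ne_of_gt (hs i); have := ne_of_gt (hs k); have := ne_of_gt (add_pos (hs i) (hs k))
    have := ne_of_gt (add_pos (pow_pos (hs i) 2) (pow_pos (hs k) 2))
    field_simp
    ring

end Certificates

/-! ## The mirror: PSD letters at `(d, d+ne, d+(n+1)e)` — NEGATIVE-type roots are at most `rank A` -/

section Mirror

variable (A J B : Matrix (Fin m) (Fin m) ℝ) (n : ℕ) (s : I → ℝ) (u : I → Fin m → ℝ)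

/-- **MIRROR LAW (reflection `t ↦ 1/t`).**  For the reduced pencil `A + sⁿ J + s^{n+1} B` (`A, B ⪰ 0`, `J` symmetric; the pivot is
now ADJACENT TO THE TOP letter: supports `(d, d+ne, d+(n+1)e)`), kernel pairs of NEGATIVE type (`s^{n+1}⟨u,Bu⟩ < n⟨u,Au⟩`, i.e. the
Rayleigh trinomial is DECREASING at its root) at distinct positive scales number at most `rank A`, given a gap-`n` certificate `N` at
the reflected nodes `σᵢ = sᵢ⁻¹`. [folklore] -/
theorem card_negType_le_rank_of_certificate (hA : A.PosSemidef) (hJ : J.IsSymm) (hB : B.PosSemidef)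
    (hs : ∀ i, 0 < s i) (hinj : Function.Injective s)
    (hker : ∀ i, (A + s i ^ n • J + s i ^ (n + 1) • B) *ᵥ u i = 0)
    (htype : ∀ i, s i ^ (n + 1) * (u i ⬝ᵥ (B *ᵥ u i)) < n * (u i ⬝ᵥ (A *ᵥ u i)))
    (N : Matrix I I ℝ) (hN : N.PosSemidef) (hNdiag : ∀ i, N i i * (n * (s i)⁻¹ ^ (n + 1)) = 1)
    (hNoff : ∀ i k, i ≠ k → N i k * ((s i)⁻¹ * (s k)⁻¹ * ((s i)⁻¹ ^ n - (s k)⁻¹ ^ n)) = (s i)⁻¹ - (s k)⁻¹) :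
    Fintype.card I ≤ A.rank := by
  refine card_posType_le_rank_of_certificate B J A n (fun i => (s i)⁻¹) u hB hJ hA (fun i => inv_pos.mpr (hs i))
    (fun i k hik => hinj (inv_injective hik)) ?_ ?_ N hN hNdiag hNoff
  · intro i
    have hsi := ne_of_gt (hs i)
    have h := congrArg (fun w => ((s i)⁻¹) ^ (n + 1) • w) (hker i)
    simp only [smul_zero] at h
    rw [← h, ← Matrix.smul_mulVec]
    congr 1
    have e1 : (s i)⁻¹ ^ (n + 1) * s i ^ n = (s i)⁻¹ := by
      rw [pow_succ', mul_assoc, ← mul_pow, inv_mul_cancel₀ hsi, one_pow, mul_one]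
    have e2 : (s i)⁻¹ ^ (n + 1) * s i ^ (n + 1) = 1 := by
      rw [← mul_pow, inv_mul_cancel₀ hsi, one_pow]
    rw [smul_add, smul_add, smul_smul, smul_smul, e1, e2, one_smul]
    abel
  · intro i
    have hsi := hs i
    have ht := htype i
    have hpow : 0 < (s i)⁻¹ ^ (n + 1) := pow_pos (inv_pos.mpr hsi) _
    -- multiply the type inequality by `s⁻⁽ⁿ⁺¹⁾`
    have h1 : (s i)⁻¹ ^ (n + 1) * (s i ^ (n + 1) * (u i ⬝ᵥ (B *ᵥ u i))) < (s i)⁻¹ ^ (n + 1) * (n * (u i ⬝ᵥ (A *ᵥ u i))) :=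
      mul_lt_mul_of_pos_left ht hpow
    have h2 : (s i)⁻¹ ^ (n + 1) * s i ^ (n + 1) = 1 := by rw [inv_pow]; exact inv_mul_cancel₀ (pow_ne_zero _ (ne_of_gt hsi))
    calc u i ⬝ᵥ (B *ᵥ u i) = (s i)⁻¹ ^ (n + 1) * (s i ^ (n + 1) * (u i ⬝ᵥ (B *ᵥ u i))) := by rw [← mul_assoc, h2, one_mul]
      _ < (s i)⁻¹ ^ (n + 1) * (n * (u i ⬝ᵥ (A *ᵥ u i))) := h1
      _ = n * (s i)⁻¹ ^ (n + 1) * (u i ⬝ᵥ (A *ᵥ u i)) := by ring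

/-- **mirror, gap `n = 2` (`(d, d+2e, d+3e)`)**: negative-type kernel pairs of `A + s²J + s³B` (`s³⟨u,Bu⟩ < 2⟨u,Au⟩`) number at most
`rank A` (Cauchy certificate at the nodes `sᵢ⁻¹`). [folklore] -/
theorem card_negType_le_rank_gap_two (hA : A.PosSemidef) (hJ : J.IsSymm) (hB : B.PosSemidef)
    (hs : ∀ i, 0 < s i) (hinj : Function.Injective s)
    (hker : ∀ i, (A + s i ^ 2 • J + s i ^ 3 • B) *ᵥ u i = 0)
    (htype : ∀ i, s i ^ 3 * (u i ⬝ᵥ (B *ᵥ u i)) < 2 * (u i ⬝ᵥ (A *ᵥ u i))) :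
    Fintype.card I ≤ A.rank := by
  classical
  set σ : I → ℝ := fun i => (s i)⁻¹ with hσ
  have hσpos : ∀ i, 0 < σ i := fun i => inv_pos.mpr (hs i)
  set N : Matrix I I ℝ := Matrix.of fun i k => (σ i)⁻¹ * (1 / (σ i + σ k)) * (σ k)⁻¹ with hNdef
  refine card_negType_le_rank_of_certificate A J B 2 s u hA hJ hB hs hinj (by simpa using hker)
    (fun i => by have := htype i; push_cast; linarith) N ?_ ?_ ?_
  · have hNeq : N = (Matrix.diagonal fun i => (σ i)⁻¹) * (Matrix.of fun i k : I => 1 / (σ i + σ k))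
        * (Matrix.diagonal fun i => (σ i)⁻¹) := by
      ext i k
      simp only [hNdef, Matrix.of_apply, Matrix.mul_diagonal, Matrix.diagonal_mul]
    rw [hNeq]
    have h := (posSemidef_cauchy σ hσpos).conjTranspose_mul_mul_same (Matrix.diagonal fun i => (σ i)⁻¹)
    rwa [Matrix.conjTranspose_eq_transpose_of_trivial, Matrix.diagonal_transpose] at h
  · intro i
    simp only [hNdef, Matrix.of_apply, hσ, inv_inv, inv_pow]
    have := ne_of_gt (hs i)
    field_simp
    ring
  · intro i k hik
    simp only [hNdef, Matrix.of_apply, hσ, inv_inv, inv_pow]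
    have := ne_of_gt (hs i); have := ne_of_gt (hs k)
    have : s i + s k ≠ 0 := ne_of_gt (add_pos (hs i) (hs k))
    have : s k + s i ≠ 0 := ne_of_gt (add_pos (hs k) (hs i))
    field_simp
    ring

end Mirror

end TwoSidedThree

end Summit.ValiantsHypothesis.ValiantsHypothesis.Theorems.KPlusLogSqLaw.TowerGraft
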